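import Literature.Probability.RandomPlanarGeometry.RestrictionDerivOuter
import Literature.Probability.RandomPlanarGeometry.RestrictionConfigEvents
import Literature.Probability.RandomPlanarGeometry.HullSubordination
import Literature.Probability.RandomPlanarGeometry.StarHullCanonical
import HarnessLib

/-!
# Dyadic outer hulls of a `*`-hull and the continuity of `Φ'` along them

A countable, combinatorial approximation of a `*`-hull `B ∈ 𝒬*` from OUTSIDE, for measurability
purposes ([LSW] §5 needs `ω ↦ Φ'_{A_t}(W_t)` to be a random variable). Given any sequence
`(b_k)` of points of `B` dense in `B`:

* `outerConfig b n` — the (finite) set of dyadic squares `Q` of generation `n` with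
  `dist(b_k, Q) < 1/2ⁿ` for some `k`; it depends on `B` only through countably many conditions on
  the points `b_k`;
* `outerSet n F = ⋃_{Q ∈ F} cthickening (1/2ⁿ) Q` and `outerHull n F = hpFill (outerSet n F)`;
* `subset_outerSet`, `outerSet_subset_cthickening` — `B ⊆ outerSet ⊆ cthickening (4/2ⁿ) B`;
* `isStarHull_outerHull` — for `n` large `outerHull n (outerConfig b n)` is a `*`-hull with
  `B ⊆ outerHull ⊆ thickHull B (4/2ⁿ)` (the set is closed, bounded, attached to `ℝ` through `B`,
  and `isStarHull_hpFill`);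
* `tendsto_starDeriv_outerHull` — **`Φ'_{outerHull_n}(0) → Φ'_B(0)`**: antitonicity
  (`HasRestrictionDeriv.le_of_subset`) and outer continuity
  (`HasRestrictionDeriv.exists_forall_outer_ge`).

## References

* G. F. Lawler, O. Schramm, W. Werner, *Conformal restriction: the chordal case* (2003), §2
  (2.4), §5 [LawlerSchrammWerner2003Restriction].
-/

noncomputable section

open Set Filter Metric Function Bornology
open _root_.Complex _root_.Topology
open UpperHalfPlane (upperHalfPlaneSet)
open scoped NNReal

namespace Literature.Probability.RandomPlanarGeometry

variable {B : Set ℂ} {b : ℕ → ℂ}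

/-! ### The construction -/

/-- The selected squares of generation `n`: those within `1/2ⁿ` of some point `b_k`. [folklore] -/
def outerConfig (b : ℕ → ℂ) (n : ℕ) : Set (ℤ × ℤ) :=
  {p | ∃ k, infDist (b k) (dyadicSquare n p.1 p.2) < 1 / 2 ^ n}

/-- The union of the `1/2ⁿ`-thickened selected squares. [folklore] -/
def outerSet (n : ℕ) (F : Set (ℤ × ℤ)) : Set ℂ := ⋃ p ∈ F, cthickening (1 / 2 ^ n) (dyadicSquare n p.1 p.2)

/-- **The dyadic outer hull**: the half-plane fill of `outerSet`. [folklore] -/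
def outerHull (n : ℕ) (F : Set (ℤ × ℤ)) : Set ℂ := hpFill (outerSet n F)

/-- Dyadic squares are nonempty, compact and contained in a ball of radius `2/2ⁿ` about any of
their points. [folklore] -/
theorem dyadicSquare_nonempty_isCompact (n : ℕ) (a c : ℤ) :
    (dyadicSquare n a c).Nonempty ∧ IsCompact (dyadicSquare n a c) := by
  have h2 : (0 : ℝ) < 2 ^ n := by positivity
  have hmem : (⟨(a : ℝ) / 2 ^ n, (c : ℝ) / 2 ^ n⟩ : ℂ) ∈ dyadicSquare n a c := by
    refine ⟨le_rfl, ?_, le_rfl, ?_⟩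
    · show (a : ℝ) / 2 ^ n ≤ ((a : ℝ) + 1) / 2 ^ n
      gcongr; linarith
    · show (c : ℝ) / 2 ^ n ≤ ((c : ℝ) + 1) / 2 ^ n
      gcongr; linarith
  refine ⟨⟨_, hmem⟩, Metric.isCompact_of_isClosed_isBounded isClosed_dyadicSquare ?_⟩
  refine (isBounded_closedBall (x := (⟨(a : ℝ) / 2 ^ n, (c : ℝ) / 2 ^ n⟩ : ℂ)) (r := 2 / 2 ^ n)).subset fun z hz ↦ ?_
  rw [mem_closedBall]
  exact dist_le_of_mem_dyadicSquare hz hmem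

/-- Membership in a closed thickening of a compact nonempty set is witnessed by a point.
[folklore] -/
theorem exists_dist_le_of_mem_cthickening {S : Set ℂ} (hS : IsCompact S) {δ : ℝ} (hδ : 0 ≤ δ)
    {z : ℂ} (hz : z ∈ cthickening δ S) : ∃ y ∈ S, dist z y ≤ δ := by
  rw [cthickening_eq_biUnion_closedBall S hδ, hS.isClosed.closure_eq] at hz
  obtain ⟨y, hy, hzy⟩ := mem_iUnion₂.1 hz
  exact ⟨y, hy, mem_closedBall.1 hzy⟩

/-! ### `B ⊆ outerSet ⊆ cthickening (4/2ⁿ) B` -/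

/-- **`B ⊆ outerSet n (outerConfig b n)`**: the dyadic square through a point of `B` is selected,
because the `b_k` are dense in `B`. [folklore] -/
theorem subset_outerSet (hdense : B ⊆ closure (range b)) (n : ℕ) : B ⊆ outerSet n (outerConfig b n) := by
  intro z hz
  have h2 : (0 : ℝ) < 1 / 2 ^ n := by positivity
  set Q := dyadicSquare n ⌊(2 : ℝ) ^ n * z.re⌋ ⌊(2 : ℝ) ^ n * z.im⌋ with hQ
  have hzQ : z ∈ Q := mem_dyadicSquare_floor z n
  obtain ⟨_, ⟨k, rfl⟩, hk⟩ := Metric.mem_closure_iff.1 (hdense hz) (1 / 2 ^ n) h2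
  have hsel : (⌊(2 : ℝ) ^ n * z.re⌋, ⌊(2 : ℝ) ^ n * z.im⌋) ∈ outerConfig b n := by
    refine ⟨k, lt_of_le_of_lt (infDist_le_dist_of_mem hzQ) ?_⟩
    rwa [dist_comm]
  exact mem_iUnion₂.2 ⟨_, hsel, self_subset_cthickening _ hzQ⟩

/-- **`outerSet n (outerConfig b n) ⊆ cthickening (4/2ⁿ) B`** when all `b_k ∈ B`: a point of a
thickened selected square is within `1/2ⁿ + 2/2ⁿ + 1/2ⁿ` of some `b_k`. [folklore] -/
theorem outerSet_subset_cthickening (hb : ∀ k, b k ∈ B) (n : ℕ) :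
    outerSet n (outerConfig b n) ⊆ cthickening (4 / 2 ^ n) B := by
  intro z hz
  obtain ⟨p, hp, hzp⟩ := mem_iUnion₂.1 hz
  obtain ⟨k, hk⟩ := hp
  obtain ⟨hQne, hQc⟩ := dyadicSquare_nonempty_isCompact n p.1 p.2
  obtain ⟨y₁, hy₁, hzy₁⟩ := exists_dist_le_of_mem_cthickening hQc (by positivity) hzp
  obtain ⟨y₀, hy₀, hy₀d⟩ := hQc.exists_infDist_eq_dist hQne (b k)
  have h1 : dist (b k) y₀ < 1 / 2 ^ n := by rw [← hy₀d]; exact hk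
  have h2 : dist y₁ y₀ ≤ 2 / 2 ^ n := dist_le_of_mem_dyadicSquare hy₁ hy₀
  refine mem_cthickening_of_dist_le z (b k) _ B (hb k) ?_
  calc dist z (b k) ≤ dist z y₁ + dist y₁ y₀ + dist y₀ (b k) := dist_triangle4 _ _ _ _
    _ ≤ 1 / 2 ^ n + 2 / 2 ^ n + 1 / 2 ^ n := by rw [dist_comm y₀]; linarith
    _ = 4 / 2 ^ n := by ring

/-! ### Finiteness, closedness, boundedness, attachment -/

/-- Only finitely many squares are selected when the `b_k` lie in a bounded set. [folklore] -/
theorem finite_outerConfig (hbdd : IsBounded (range b)) (n : ℕ) : (outerConfig b n).Finite := by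
  refine (finite_setOf_dyadicSquare_inter_nonempty (hbdd.thickening (δ := 1 / 2 ^ n)) n).subset ?_
  rintro p ⟨k, hk⟩
  obtain ⟨hQne, hQc⟩ := dyadicSquare_nonempty_isCompact n p.1 p.2
  obtain ⟨y₀, hy₀, hy₀d⟩ := hQc.exists_infDist_eq_dist hQne (b k)
  refine ⟨y₀, hy₀, ?_⟩
  rw [mem_thickening_iff]
  exact ⟨b k, ⟨k, rfl⟩, by rw [dist_comm, ← hy₀d]; exact hk⟩

/-- For a finite configuration the outer set is closed. [folklore] -/
theorem isClosed_outerSet {F : Set (ℤ × ℤ)} (hF : F.Finite) (n : ℕ) : IsClosed (outerSet n F) :=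
  hF.isClosed_biUnion fun _ _ ↦ isClosed_cthickening

/-- The outer set of a bounded `B` is bounded. [folklore] -/
theorem isBounded_outerSet (hB : IsBounded B) (hb : ∀ k, b k ∈ B) (n : ℕ) :
    IsBounded (outerSet n (outerConfig b n)) :=
  (hB.cthickening).subset (outerSet_subset_cthickening hb n)

/-- **The outer set is attached to `ℝ` through `B`**: `outerSet ∪ {Im ≤ 0}` is connected, for `B`
a bounded hull containing the `b_k` densely (each thickened selected square is convex and
contains some `b_k ∈ B`, and `B ∪ {Im ≤ 0}` is connected). [folklore] -/
theorem isConnected_outerSet_union (hB : IsBoundedHull B) (hb : ∀ k, b k ∈ B) (hdense : B ⊆ closure (range b))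
    (n : ℕ) : IsConnected (outerSet n (outerConfig b n) ∪ {z : ℂ | z.im ≤ 0}) := by
  have hC := hB.isConnected_union_im_nonpos
  have hsub : B ∪ {z : ℂ | z.im ≤ 0} ⊆ outerSet n (outerConfig b n) ∪ {z : ℂ | z.im ≤ 0} :=
    union_subset_union_left _ (subset_outerSet hdense n)
  refine ⟨⟨0, Or.inr (by simp)⟩, isPreconnected_of_forall 0 fun y hy ↦ ?_⟩
  have h0 : (0 : ℂ) ∈ B ∪ {z : ℂ | z.im ≤ 0} := Or.inr (by simp)
  rcases hy with hyS | hyL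
  · obtain ⟨p, hp, hyp⟩ := mem_iUnion₂.1 hyS
    obtain ⟨k, hk⟩ := hp
    -- the thickened square `T` is convex and contains `b k ∈ B`
    set T := cthickening (1 / 2 ^ n) (dyadicSquare n p.1 p.2) with hT
    have hTconv : Convex ℝ T := convex_dyadicSquare.cthickening _
    have hbkT : b k ∈ T := by
      obtain ⟨hQne, hQc⟩ := dyadicSquare_nonempty_isCompact n p.1 p.2
      obtain ⟨y₀, hy₀, hy₀d⟩ := hQc.exists_infDist_eq_dist hQne (b k)
      exact mem_cthickening_of_dist_le _ y₀ _ _ hy₀ (by rw [← hy₀d]; exact hk.le)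
    have hTsub : T ⊆ outerSet n (outerConfig b n) := fun w hw ↦ mem_iUnion₂.2 ⟨p, ⟨k, hk⟩, hw⟩
    refine ⟨(B ∪ {z : ℂ | z.im ≤ 0}) ∪ T, union_subset hsub (hTsub.trans subset_union_left), Or.inl h0, Or.inr hyp, ?_⟩
    exact hC.isPreconnected.union (b k) (Or.inl (hb k)) hbkT hTconv.isPreconnected
  · exact ⟨B ∪ {z : ℂ | z.im ≤ 0}, hsub, h0, Or.inr hyL, hC.isPreconnected⟩

/-! ### The fill only sees `ℍ̄`, and the outer hull is a thin `*`-hull around `B` -/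

/-- The half-plane fill only depends on the part of the set in `{Im ≥ 0}`. [folklore] -/
theorem hpFill_inter_im_nonneg (S : Set ℂ) : hpFill (S ∩ {z : ℂ | 0 ≤ z.im}) = hpFill S := by
  have : upperHalfPlaneSet \ (S ∩ {z : ℂ | 0 ≤ z.im}) = upperHalfPlaneSet \ S := by
    ext z
    simp only [Set.mem_sdiff, mem_inter_iff, mem_setOf_eq, not_and, not_le]
    constructor
    · rintro ⟨hz, h⟩
      exact ⟨hz, fun hS ↦ absurd (h hS) (not_lt.2 (le_of_lt (show 0 < z.im from hz)))⟩
    · rintro ⟨hz, h⟩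
      exact ⟨hz, fun hS ↦ absurd hS h⟩
  rw [hpFill, hpFill, this]

/-- `outerHull ⊆ thickHull B (4/2ⁿ)`. [folklore] -/
theorem outerHull_subset_thickHull (hb : ∀ k, b k ∈ B) (n : ℕ) :
    outerHull n (outerConfig b n) ⊆ thickHull B (4 / 2 ^ n) := by
  rw [outerHull, ← hpFill_inter_im_nonneg, thickHull]
  exact hpFill_mono (inter_subset_inter_left _ (outerSet_subset_cthickening hb n))

/-- `B ⊆ outerHull` for a bounded hull `B`. [folklore] -/
theorem subset_outerHull (hB : IsBoundedHull B) (hdense : B ⊆ closure (range b)) (n : ℕ) :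
    B ⊆ outerHull n (outerConfig b n) := by
  have h1 : B ∩ upperHalfPlaneSet ⊆ outerHull n (outerConfig b n) :=
    (inter_subset_inter_left _ (subset_outerSet hdense n)).trans (inter_subset_hpFill _)
  rw [← hB.2.1]
  exact closure_minimal h1 (isClosed_hpFill _)

/-- **For `n` large the outer hull is a `*`-hull with `B ⊆ outerHull ⊆ thickHull B (4/2ⁿ)`.**
[cite: LawlerSchrammWerner2003Restriction, §2 p. 8 (Fillings)] -/
theorem isStarHull_outerHull (hB : IsStarHull B) (hb : ∀ k, b k ∈ B) (hdense : B ⊆ closure (range b)) :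
    ∀ᶠ n in atTop, IsStarHull (outerHull n (outerConfig b n)) ∧ B ⊆ outerHull n (outerConfig b n) ∧
      outerHull n (outerConfig b n) ⊆ thickHull B (4 / 2 ^ n) := by
  obtain ⟨s₀, hs₀, h0⟩ := exists_forall_zero_notMem_thickHull hB
  have hsmall : ∀ᶠ n : ℕ in atTop, (4 : ℝ) / 2 ^ n < s₀ := by
    have h1 : Tendsto (fun n : ℕ ↦ (4 : ℝ) / 2 ^ n) atTop (𝓝 0) := by
      have := (tendsto_pow_atTop_nhds_zero_of_lt_one (r := (1 / 2 : ℝ)) (by norm_num) (by norm_num)).const_mul (4 : ℝ)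
      rw [mul_zero] at this
      refine this.congr fun n ↦ ?_
      rw [one_div, inv_pow, div_eq_mul_inv]
    exact h1.eventually (gt_mem_nhds hs₀)
  filter_upwards [hsmall] with n hn
  have hbdd : IsBounded (range b) := hB.isBoundedHull.isCompact.isBounded.subset (range_subset_iff.2 hb)
  have hfin := finite_outerConfig hbdd n
  have hsub := outerHull_subset_thickHull (B := B) hb n
  have hstar : IsStarHull (outerHull n (outerConfig b n)) := by
    refine isStarHull_hpFill isSimplyConnected_of_isConnected_compl_holds (isClosed_outerSet hfin n)
      (isBounded_outerSet hB.isBoundedHull.isCompact.isBounded hb n) (isConnected_outerSet_union hB.isBoundedHull hb hdense n) ?_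
    exact fun h ↦ h0 _ (by positivity) hn (hsub h)
  exact ⟨hstar, subset_outerHull hB.isBoundedHull hdense n, hsub⟩

/-! ### `Φ'_{outerHull_n}(0) → Φ'_B(0)` -/

/-- **Continuity of `Φ'` along the dyadic outer hulls**: `starDeriv (outerHull n (outerConfig b n))`
tends to `starDeriv B` (antitonicity gives `≤`, outer continuity gives `≥ (1 - ε)·`).
[cite: LawlerSchrammWerner2003Restriction, §2 (2.4)] -/
theorem tendsto_starDeriv_outerHull (hB : IsStarHull B) (hne : B.Nonempty) (hb : ∀ k, b k ∈ B)
    (hdense : B ⊆ closure (range b)) :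
    Tendsto (fun n ↦ starDeriv (outerHull n (outerConfig b n))) atTop (𝓝 (starDeriv B)) := by
  obtain ⟨hd0, hd1, hd⟩ := starDeriv_spec hB
  rw [Metric.tendsto_atTop]
  intro ε hε
  -- outer continuity with relative error `ε' = min (ε/d) (1/2)`-ish: use `ε₁ := ε / 2 / d ∧ 1/2`
  set ε₁ : ℝ := min (ε / (2 * starDeriv B)) (1 / 2) with hε₁
  have hε₁0 : 0 < ε₁ := lt_min (by positivity) (by norm_num)
  obtain ⟨δ, hδ, hout⟩ := hd.exists_forall_outer_ge hB hne (isRestrictionMap_starRMap hB) hε₁0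
  have hsmall : ∀ᶠ n : ℕ in atTop, (4 : ℝ) / 2 ^ n ≤ δ := by
    have h1 : Tendsto (fun n : ℕ ↦ (4 : ℝ) / 2 ^ n) atTop (𝓝 0) := by
      have := (tendsto_pow_atTop_nhds_zero_of_lt_one (r := (1 / 2 : ℝ)) (by norm_num) (by norm_num)).const_mul (4 : ℝ)
      rw [mul_zero] at this
      refine this.congr fun n ↦ ?_
      rw [one_div, inv_pow, div_eq_mul_inv]
    exact h1.eventually (ge_mem_nhds hδ)
  obtain ⟨N, hN⟩ := (hsmall.and (isStarHull_outerHull hB hb hdense)).exists_forall_of_atTop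
  refine ⟨N, fun n hn ↦ ?_⟩
  obtain ⟨hδn, hstar, hBsub, hthick⟩ := hN n hn
  obtain ⟨-, -, hdn⟩ := starDeriv_spec hstar
  have hHsub : outerHull n (outerConfig b n) ⊆ thickHull B δ := hthick.trans (thickHull_mono _ hδn)
  have hge := hout hstar hBsub hHsub (isRestrictionMap_starRMap hstar) hdn
  have hle := HasRestrictionDeriv.le_of_subset hstar hB hBsub (isRestrictionMap_starRMap hstar) (isRestrictionMap_starRMap hB) hdn hd
  rw [Real.dist_eq, abs_lt]
  have h1 : ε₁ * starDeriv B ≤ ε / 2 := by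
    have := min_le_left (ε / (2 * starDeriv B)) (1 / 2)
    calc ε₁ * starDeriv B ≤ ε / (2 * starDeriv B) * starDeriv B := mul_le_mul_of_nonneg_right this hd0.le
      _ = ε / 2 := by field_simp
  constructor <;> nlinarith

end Literature.Probability.RandomPlanarGeometry
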